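import Literature.NumberTheory.GelbartRogawski1991.UnitaryDualPairWeilCoinvariants
import Literature.NumberTheory.Weil1964.AdelicMetaplecticTwistCharacter
import HarnessLib

/-!
# The finite Weil representation of a dual pair does not see the splitting: comparison with ANY finite-adelic section

[GelbartRogawski1991, §3.1 Remark p. 457 L4–13]: a compatible splitting is pinned by Prop. 3.1.1 only up to central
twists `s ↦ s ⊗ ν′`; [Liu2021, App. D §D.1 Steps 1–3 (l. 5214–5219), Def. 4.11 (l. 2092–2096)] builds
`ω(μ, ε, χ) := ⊗'_v ω(μ_v, ε_v, χ_v)` from LOCAL splittings `ι_{μ_v}` place by place.  The tree's finite Weil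
representation of the dual pair `U(J_V) × U(J_W)` (`finPairRep hs`, `UnitaryDualPairWeilCoinvariants`) and its
`χ`-coinvariants `Ω(s, χ) = weilCoinv χ hs` are built from the ABSTRACT compatible splitting `s` delivered by the cited
Prop. 3.1.1 (`hGR`, through `Classical.choice`).  This file proves that they are determined, UP TO A CONTINUOUS CHARACTER,
by the symplectic map alone: for ANY homomorphism
`s₀ : U(J_V)(𝔸_{F,f}) × U(J_W)(𝔸_{F,f}) →* Mp_ψ(𝕎_{T_V ⊗ T_W})ᶜᵒⁿᵗ` over the same symplectic map as the finite-adelic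
restriction `σ_s := pairSmall₁ s ∘ finPairToAdelic` of the pair splitting (hypothesis `hproj`; e.g. a section assembled
from local splittings, `LocalSplitting.FinLocalSplittings.finSplitting`),

* §0 the hypothesis `hker` of `SplittingDatum.IsCompatible.exists_central_twist` holds at the datum of record
  (`splittingDatum_hker`, from `adelicMpCont.mem_center_of_proj_eq_one`), so two compatible splittings of the dual pair
  differ by a homomorphism into `ker π` trivial on `G₁(F)` — UNCONDITIONALLY (`exists_central_twist_of_isCompatible`);
* §1 `σ_s = s₀ ⊗ χ` for a character `χ` of the finite-adelic pair (`exists_eq_twist_finPairSection`), continuous when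
  `s_pair` and `s₀` are; and for any such `χ`: **`finPairRep hs p f = χ(p) • ω_f^{s₀}(p) f`**
  (`finPairRep_eq_smul_of_eq_twist`, `ω_f^{s₀} = finRepMp … s₀`), member forms `finPairRepV_…`, `finPairRepW_…`;
* §2 hence the `χ'`-relations of `finPairRepW hs` are the `χ''`-relations of the `U(J_W)`-member of `ω_f^{s₀}` whenever
  `χ' = χ(1, ·) · χ''` (`ker_finPairRepW_eq_of_eq_twist`), the identification
  **`Ω(s, χ') ≃ₗ[ℂ] Coinv (ω_f^{s₀}|_{U(J_W)}) χ''`** (`mk f ↦ mk f`) with its intertwining law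
  `T (Ω(s, χ')(k) x) = χ(k, 1) • rep(ω_f^{s₀}|_{U(J_V)}) k (T x)` (`exists_weilCoinv_equiv_reference`); in particular
  `Ω(s, χ') ≠ 0 ↔ Coinv(ω_f^{s₀}|_{U(J_W)}, χ'') ≠ 0` (`nontrivial_weilCoinv_iff_reference`).

So the non-vanishing / restricted-tensor-product structure of Liu's `ω(μ, ε, χ)` (the tree's
`IsRestrictedTensorProductRep.centralCoinv`, `FinLocalSplittings.omegaPi_centralCoinv_nontrivial`) transfers to the
abstract-`s` carrier `Ω(s, χ)` as soon as ONE finite-adelic section `s₀` with those properties is exhibited; the abstract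
`s` of Prop. 3.1.1 is no longer an obstacle.  Theorems only: 0 definitions, 0 named facts, 0 `sorry`.

## References
* [GelbartRogawski1991] S. Gelbart, J. Rogawski, *L-functions and Fourier–Jacobi coefficients for the unitary group
  U(3)*, Invent. Math. 105 (1991), §3.1 p. 454 L21–33, Prop. 3.1.1 p. 455 L1–3, Remark p. 457 L4–13.
* [Liu2021] Y. Liu, *Fourier–Jacobi cycles and arithmetic relative trace formula*, Camb. J. Math. 9 (2021) =
  arXiv:2102.11518, Def. 4.11 (l. 2092–2096), App. D §D.1 Steps 1–3 (l. 5214–5219).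
* [Weil1964] A. Weil, *Sur certains groupes d'opérateurs unitaires*, Acta Math. 111 (1964), Chap. III n° 37–39.
-/

noncomputable section

namespace Literature.NumberTheory.GelbartRogawski1991.UnitaryDualPair.WeilCoinv

open Literature.NumberTheory.GelbartRogawski1991 Literature.NumberTheory.GelbartRogawski1991.UnitaryDualPair
open Literature.NumberTheory.Automorphic Literature.NumberTheory.Weil1964
open Literature.RepresentationTheory
open scoped Kronecker
open NumberField NumberField.mixedEmbedding IsDedekindDomain

variable (F E : Type) [Field F] [NumberField F] [Field E] [NumberField E] [Algebra F E]
variable (c : E ≃ₐ[F] E) (N M : ℕ) {n : ℕ} (e : Fin N × Fin M ≃ Fin n)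
variable (JV : Matrix (Fin N) (Fin N) E) (JW : Matrix (Fin M) (Fin M) E)
variable {TV : Matrix (Fin N) (Fin N) F} {TW : Matrix (Fin M) (Fin M) F}
variable [Algebra.IsQuadraticExtension F E] {δ : E} (hcδ : c δ = -δ) (hδ : δ ≠ 0) {d : F}
  (hd : δ * δ = algebraMap F E d) (hV : TV.IsSymm) (hW : TW.IsSymm) (hVd : IsUnit TV.det) (hWd : IsUnit TW.det)
  (hJV : JV = TV.map (algebraMap F E)) (hJW : JW = TW.map (algebraMap F E))
  {s : UnitaryGroup.adelicPair F E c N M JV JW →* adelicMpCont F (Fin n) (adelicGram F e TV TW)}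

/-! ## §0 The kernel of `π` is central at the datum of record: compatible splittings differ by central twists -/

section Hker

include hVd hWd in
/-- the adelic Gram matrix `𝕋 = reindex e e (T_V ⊗ 1 ⊗ₖ T_W ⊗ 1)` is invertible. [cite: GelbartRogawski1991, §3.1 p. 454 L21–33] -/
theorem isUnit_adelicGram : IsUnit (adelicGram F e TV TW) :=
  (Matrix.isUnit_iff_isUnit_det _).2 (isUnit_det_adelicGram F e hVd hWd)

/-- **the hypothesis `hker` of `SplittingDatum.IsCompatible.exists_central_twist` at the datum of record**: an element
of `Mp_ψ(𝕎_𝔸)ᶜᵒⁿᵗ` over `1` is central (it is a scalar, `AdelicMetaplecticKernel`).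
[cite: GelbartRogawski1991, §3.1 p. 454 L21–33] -/
theorem splittingDatum_hker (m : adelicMpCont F (Fin n) (adelicGram F e TV TW))
    (hm : (splittingDatum F E c N M e JV JW hcδ hδ hd hV hW hVd hWd hJV hJW).proj m = 1) :
    m ∈ Subgroup.center (adelicMpCont F (Fin n) (adelicGram F e TV TW)) :=
  adelicMpCont.mem_center_of_proj_eq_one (isUnit_adelicGram F N M e hVd hWd) m hm

/-- **[GelbartRogawski1991, Remark p. 457] for the dual pair, UNCONDITIONALLY**: two compatible splittings `s, s'` of
`G₁(𝔸_F) = U(J_V ⊗ J_W)(𝔸_F)` differ by a homomorphism `ν : G₁(𝔸_F) →* Mp_ψ(𝕎_𝔸)ᶜᵒⁿᵗ` over `1`, trivial on `G₁(F)`: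
`s' = s · ν`. [cite: GelbartRogawski1991, §3.1 Remark p. 457 L4–13] -/
theorem exists_central_twist_of_isCompatible
    {s' : UnitaryGroup.adelicPair F E c N M JV JW →* adelicMpCont F (Fin n) (adelicGram F e TV TW)}
    (hs : (splittingDatum F E c N M e JV JW hcδ hδ hd hV hW hVd hWd hJV hJW).IsCompatible s)
    (hs' : (splittingDatum F E c N M e JV JW hcδ hδ hd hV hW hVd hWd hJV hJW).IsCompatible s') :
    ∃ ν : UnitaryGroup.adelicPair F E c N M JV JW →* adelicMpCont F (Fin n) (adelicGram F e TV TW),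
      (∀ g, (splittingDatum F E c N M e JV JW hcδ hδ hd hV hW hVd hWd hJV hJW).proj (ν g) = 1) ∧
      (∀ g, s' g = s g * ν g) ∧
      ∀ γ ∈ (splittingDatum F E c N M e JV JW hcδ hδ hd hV hW hVd hWd hJV hJW).ratPts, ν γ = 1 :=
  hs.exists_central_twist (splittingDatum_hker F E c N M e JV JW hcδ hδ hd hV hW hVd hWd hJV hJW) hs'

/-- the same read as scalars: `s' = s ⊗ ĉ` for a character `ĉ : G₁(𝔸_F) →* ℂˣ` trivial on `G₁(F)`, continuous when
`s`, `s'` are. [cite: GelbartRogawski1991, §3.1 Remark p. 457 L4–13] -/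
theorem exists_eq_twist_of_isCompatible
    {s' : UnitaryGroup.adelicPair F E c N M JV JW →* adelicMpCont F (Fin n) (adelicGram F e TV TW)}
    (hs : (splittingDatum F E c N M e JV JW hcδ hδ hd hV hW hVd hWd hJV hJW).IsCompatible s)
    (hs' : (splittingDatum F E c N M e JV JW hcδ hδ hd hV hW hVd hWd hJV hJW).IsCompatible s') :
    ∃ ĉ : UnitaryGroup.adelicPair F E c N M JV JW →* ℂˣ,
      s' = adelicMpCont.twist F (Fin n) (adelicGram F e TV TW) s ĉ ∧
      (∀ γ ∈ (splittingDatum F E c N M e JV JW hcδ hδ hd hV hW hVd hWd hJV hJW).ratPts, ĉ γ = 1) ∧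
      (Continuous s → Continuous s' → Continuous ĉ) := by
  have hproj : ∀ g, adelicMpCont.proj F (Fin n) (adelicGram F e TV TW) (s g) =
      adelicMpCont.proj F (Fin n) (adelicGram F e TV TW) (s' g) := fun g => (hs.1 g).trans (hs'.1 g).symm
  refine (adelicMpCont.exists_eq_twist s s' (isUnit_adelicGram F N M e hVd hWd) hproj).elim fun ĉ hĉ =>
    ⟨ĉ, hĉ, fun γ hγ => ?_, fun hc hc' => adelicMpCont.continuous_units_of_eq_twist hĉ hc hc'⟩
  -- on rational points both splittings take the value `i(ι γ)`, so the scalar is `1`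
  have h1 : s' γ = s γ := (hs'.apply_eq_ratSplit hγ).trans (hs.apply_eq_ratSplit hγ).symm
  have h2 : s' γ = adelicMpCont.ofScalar F (Fin n) (adelicGram F e TV TW) (ĉ γ) * s γ := by
    rw [hĉ]
    rfl
  have h3 : adelicMpCont.ofScalar F (Fin n) (adelicGram F e TV TW) (ĉ γ) = 1 :=
    mul_right_cancel (a := adelicMpCont.ofScalar F (Fin n) (adelicGram F e TV TW) (ĉ γ)) (b := s γ) (c := 1)
      ((h2.symm.trans h1).trans (one_mul _).symm)
  exact adelicMpCont.ofScalar_injective (h3.trans (map_one _).symm)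

end Hker

/-! ## §1 The finite Weil representation against a finite-adelic reference section -/

section Reference

variable (s₀ : UnitaryGroup.finAdelic F E c N JV × UnitaryGroup.finAdelic F E c M JW →*
    adelicMpCont F (Fin N × Fin M)
      (TV.map (algebraMap F (AdeleRing (𝓞 F) F)) ⊗ₖ TW.map (algebraMap F (AdeleRing (𝓞 F) F))))

/-- the intrinsic form of the hypothesis on `s₀` — "`s₀` lies over the symplectic map of the finite-adelic dual pair" —
gives the relative form `π ∘ s₀ = π ∘ (pairSmall₁ s ∘ finPairToAdelic)` used below (`proj_pairSmall₁`).
[cite: GelbartRogawski1991, §3.1 p. 454 L21–33] -/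
theorem proj_eq_proj_finPairSection_of_intrinsic
    (hs : (splittingDatum F E c N M e JV JW hcδ hδ hd hV hW hVd hWd hJV hJW).IsCompatible s)
    (hs₀ : ∀ p, adelicMpCont.proj F (Fin N × Fin M) _ (s₀ p) =
      UnitaryGroup.adelicPairToSymplectic F E c N M hcδ hδ hd hV hW hJV hJW
        (UnitaryGroup.dualPair (UnitaryGroup.conjAdele F E c) (UnitaryGroup.adelicForm E N JV)
          (UnitaryGroup.adelicForm E M JW) (finPairToAdelic F E c N M JV JW p)))
    (p : UnitaryGroup.finAdelic F E c N JV × UnitaryGroup.finAdelic F E c M JW) :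
    adelicMpCont.proj F (Fin N × Fin M) _ (s₀ p) =
      adelicMpCont.proj F (Fin N × Fin M) _
        (((pairSmall₁ F E c N M e JV JW s).comp (finPairToAdelic F E c N M JV JW)) p) :=
  (hs₀ p).trans (proj_pairSmall₁ F E c N M e JV JW hcδ hδ hd hV hW hVd hWd hJV hJW hs (finPairToAdelic F E c N M JV JW p)).symm

omit [Algebra.IsQuadraticExtension F E] in
/-- non-vacuity of the standing hypothesis `hproj` below: the cell's own finite-adelic pair section is a reference
section (and then the character of `exists_eq_twist_finPairSection` is `1`). [cite: GelbartRogawski1991, §3.1 p. 454 L21–33] -/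
theorem exists_reference_section :
    ∃ s₀ : UnitaryGroup.finAdelic F E c N JV × UnitaryGroup.finAdelic F E c M JW →*
        adelicMpCont F (Fin N × Fin M)
          (TV.map (algebraMap F (AdeleRing (𝓞 F) F)) ⊗ₖ TW.map (algebraMap F (AdeleRing (𝓞 F) F))),
      ∀ p, adelicMpCont.proj F (Fin N × Fin M) _ (s₀ p) =
        adelicMpCont.proj F (Fin N × Fin M) _
          (((pairSmall₁ F E c N M e JV JW s).comp (finPairToAdelic F E c N M JV JW)) p) :=
  ⟨(pairSmall₁ F E c N M e JV JW s).comp (finPairToAdelic F E c N M JV JW), fun _ => rfl⟩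

variable (hproj : ∀ p, adelicMpCont.proj F (Fin N × Fin M) _ (s₀ p) =
  adelicMpCont.proj F (Fin N × Fin M) _ (((pairSmall₁ F E c N M e JV JW s).comp (finPairToAdelic F E c N M JV JW)) p))

include hproj in
/-- `s₀` fixes the archimedean vectors (it lies over the same symplectic elements as the pair splitting at finite-adelic
points). [cite: Weil1964, Chap. III n° 37–38 pp. 188–190] -/
theorem harch_reference (hs : (splittingDatum F E c N M e JV JW hcδ hδ hd hV hW hVd hWd hJV hJW).IsCompatible s)
    (p : UnitaryGroup.finAdelic F E c N JV × UnitaryGroup.finAdelic F E c M JW) (a w : Fin N × Fin M → mixedSpace F) :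
    (adelicMpCont.proj F (Fin N × Fin M) _ (s₀ p)).1 (archVec F (Fin N × Fin M) a, archVec F (Fin N × Fin M) w) =
      (archVec F (Fin N × Fin M) a, archVec F (Fin N × Fin M) w) := by
  rw [hproj p]
  exact proj_pairSmall₁_finAdelic_apply_archVec F E c N M e JV JW hcδ hδ hd hV hW hVd hWd hJV hJW hs p.1 p.2 a w

omit [Algebra.IsQuadraticExtension F E] in
include hVd hWd hproj in
/-- **the finite-adelic pair section of the cell is a twist of the reference section**: `pairSmall₁ s ∘ finPairToAdelic =
s₀ ⊗ χ` for some character `χ` of `U(J_V)(𝔸_{F,f}) × U(J_W)(𝔸_{F,f})`. [cite: GelbartRogawski1991, §3.1 Remark p. 457 L4–13] -/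
theorem exists_eq_twist_finPairSection :
    ∃ χ : UnitaryGroup.finAdelic F E c N JV × UnitaryGroup.finAdelic F E c M JW →* ℂˣ,
      (pairSmall₁ F E c N M e JV JW s).comp (finPairToAdelic F E c N M JV JW) =
        adelicMpCont.twist F (Fin N × Fin M) _ s₀ χ :=
  adelicMpCont.exists_eq_twist s₀ _ (isUnit_kronecker_map F N hVd hWd) hproj

omit [Algebra.IsQuadraticExtension F E] in
include hVd hWd hproj in
/-- the same with continuity: along a continuous pair splitting and a continuous `s₀` the character is continuous.
[cite: GelbartRogawski1991, §3.1 Prop. 3.1.1 p. 455 L1–3] -/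
theorem exists_eq_twist_finPairSection_continuous (hsc : Continuous (pairSplitting F E c N M e JV JW s))
    (hc₀ : Continuous s₀) :
    ∃ χ : UnitaryGroup.finAdelic F E c N JV × UnitaryGroup.finAdelic F E c M JW →* ℂˣ, Continuous χ ∧
      (pairSmall₁ F E c N M e JV JW s).comp (finPairToAdelic F E c N M JV JW) =
        adelicMpCont.twist F (Fin N × Fin M) _ s₀ χ :=
  adelicMpCont.exists_eq_twist_continuous s₀ _ (isUnit_kronecker_map F N hVd hWd) hproj hc₀
    ((continuous_pairSmall₁ F E c N M e JV JW hsc).comp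
      ((UnitaryGroup.continuous_finAdelicToAdelic F E c N JV).prodMap
        (UnitaryGroup.continuous_finAdelicToAdelic F E c M JW)))

variable {s₀}
variable {χ : UnitaryGroup.finAdelic F E c N JV × UnitaryGroup.finAdelic F E c M JW →* ℂˣ}
  (hχ : (pairSmall₁ F E c N M e JV JW s).comp (finPairToAdelic F E c N M JV JW) = adelicMpCont.twist F (Fin N × Fin M) _ s₀ χ)
  (hs : (splittingDatum F E c N M e JV JW hcδ hδ hd hV hW hVd hWd hJV hJW).IsCompatible s)

include hχ in
/-- **`finPairRep hs p f = χ(p) • ω_f^{s₀}(p) f`** when `pairSmall₁ s ∘ finPairToAdelic = s₀ ⊗ χ`.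
[cite: GelbartRogawski1991, §3.1 Remark p. 457 L4–13; Weil1964, Chap. III n° 37–38 pp. 188–190] -/
theorem finPairRep_eq_smul_of_eq_twist (p : UnitaryGroup.finAdelic F E c N JV × UnitaryGroup.finAdelic F E c M JW)
    (f : FinSB F (Fin N × Fin M)) :
    finPairRep F E c N M e JV JW hcδ hδ hd hV hW hVd hWd hJV hJW hs p f =
      ((χ p : ℂˣ) : ℂ) • finRepMp (isUnit_kronecker_map F N hVd hWd) s₀
        (harch_reference F E c N M e JV JW hcδ hδ hd hV hW hVd hWd hJV hJW s₀ hproj hs) p f :=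
  finRepMp_eq_smul_of_eq_twist (isUnit_kronecker_map F N hVd hWd) hχ
    (harch_reference F E c N M e JV JW hcδ hδ hd hV hW hVd hWd hJV hJW s₀ hproj hs)
    (fun p a w => proj_pairSmall₁_finAdelic_apply_archVec F E c N M e JV JW hcδ hδ hd hV hW hVd hWd hJV hJW hs
      p.1 p.2 a w) p f

include hχ in
/-- `U(J_V)`-member: `finPairRepV hs k f = χ(k, 1) • ω_f^{s₀}(k, 1) f`. [cite: GelbartRogawski1991, §3.1 Remark p. 457 L4–13] -/
theorem finPairRepV_eq_smul_of_eq_twist (k : UnitaryGroup.finAdelic F E c N JV) (f : FinSB F (Fin N × Fin M)) :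
    finPairRepV F E c N M e JV JW hcδ hδ hd hV hW hVd hWd hJV hJW hs k f =
      ((χ (k, 1) : ℂˣ) : ℂ) • finRepMp (isUnit_kronecker_map F N hVd hWd) s₀
        (harch_reference F E c N M e JV JW hcδ hδ hd hV hW hVd hWd hJV hJW s₀ hproj hs) (k, 1) f :=
  finPairRep_eq_smul_of_eq_twist F E c N M e JV JW hcδ hδ hd hV hW hVd hWd hJV hJW hproj hχ hs (k, 1) f

include hχ in
/-- `U(J_W)`-member: `finPairRepW hs u f = χ(1, u) • ω_f^{s₀}(1, u) f`. [cite: GelbartRogawski1991, §3.1 Remark p. 457 L4–13] -/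
theorem finPairRepW_eq_smul_of_eq_twist (u : UnitaryGroup.finAdelic F E c M JW) (f : FinSB F (Fin N × Fin M)) :
    finPairRepW F E c N M e JV JW hcδ hδ hd hV hW hVd hWd hJV hJW hs u f =
      ((χ (1, u) : ℂˣ) : ℂ) • finRepMp (isUnit_kronecker_map F N hVd hWd) s₀
        (harch_reference F E c N M e JV JW hcδ hδ hd hV hW hVd hWd hJV hJW s₀ hproj hs) (1, u) f :=
  finPairRep_eq_smul_of_eq_twist F E c N M e JV JW hcδ hδ hd hV hW hVd hWd hJV hJW hproj hχ hs (1, u) f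

/-! ## §2 The Weil coinvariants against the reference section -/

/-- the two members of ANY representation of a product group commute. [cite: GelbartRogawski1991, §3.1 Prop. 3.1.1 p. 455 L1–3] -/
theorem commute_comp_inl_comp_inr {G₁ G₂ V : Type*} [Group G₁] [Group G₂] [AddCommGroup V] [Module ℂ V]
    (ρ : Representation ℂ (G₁ × G₂) V) (a : G₁) (b : G₂) :
    Commute (ρ.comp (MonoidHom.inl G₁ G₂) a) (ρ.comp (MonoidHom.inr G₁ G₂) b) := by
  change ρ (a, 1) * ρ (1, b) = ρ (1, b) * ρ (a, 1)
  rw [← map_mul, ← map_mul, Prod.mk_mul_mk, Prod.mk_mul_mk, mul_one, one_mul, mul_one, one_mul]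

include hχ in
/-- **Equal relation submodules**: for `χ' = χ(1, ·) · χ''` the `χ'`-relations of `finPairRepW hs` are the
`χ''`-relations of the `U(J_W)`-member of `ω_f^{s₀}`. [cite: GelbartRogawski1991, §3.1 Remark p. 457 L4–13] -/
theorem ker_finPairRepW_eq_of_eq_twist {χ' χ'' : UnitaryGroup.finAdelic F E c M JW →* ℂˣ}
    (hχ' : ∀ u, χ' u = χ (1, u) * χ'' u) :
    TwistedCoinv.ker (finPairRepW F E c N M e JV JW hcδ hδ hd hV hW hVd hWd hJV hJW hs) χ' =
      TwistedCoinv.ker ((finRepMp (isUnit_kronecker_map F N hVd hWd) s₀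
        (harch_reference F E c N M e JV JW hcδ hδ hd hV hW hVd hWd hJV hJW s₀ hproj hs)).comp
          (MonoidHom.inr _ _)) χ'' :=
  TwistedCoinv.ker_eq_of_forall_smul (fun u => χ (1, u))
    (fun u f => finPairRepW_eq_smul_of_eq_twist F E c N M e JV JW hcδ hδ hd hV hW hVd hWd hJV hJW hproj hχ hs u f) hχ'

variable {χ' χ'' : UnitaryGroup.finAdelic F E c M JW →* ℂˣ} (hχ' : ∀ u, χ' u = χ (1, u) * χ'' u)

include hχ hχ' in
/-- **`Ω(s, χ') ≅ Coinv(ω_f^{s₀}|_{U(J_W)}, χ'')`, equivariantly up to the twist `χ(·, 1)`** (for `χ' = χ(1, ·) · χ''`):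
the quotients of `𝒮((𝔸_F^∞)^{NM})` by the SAME submodule (`Submodule.quotEquivOfEq`; `mk f ↦ mk f`), with the intertwining
law `T (Ω(s, χ')(k) x) = χ(k, 1) • rep(ω_f^{s₀}|_{U(J_V)}) k (T x)` — i.e. `Ω(s, χ')` IS the `χ''`-coinvariant representation
of the reference section twisted by the `U(J_V)`-part of `χ`. [cite: GelbartRogawski1991, §3.1 Remark p. 457 L4–13] -/
theorem exists_weilCoinv_equiv_reference :
    ∃ T : TwistedCoinv.Coinv (finPairRepW F E c N M e JV JW hcδ hδ hd hV hW hVd hWd hJV hJW hs) χ' ≃ₗ[ℂ]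
        TwistedCoinv.Coinv ((finRepMp (isUnit_kronecker_map F N hVd hWd) s₀
          (harch_reference F E c N M e JV JW hcδ hδ hd hV hW hVd hWd hJV hJW s₀ hproj hs)).comp (MonoidHom.inr _ _)) χ'',
      (∀ f : FinSB F (Fin N × Fin M),
        T (TwistedCoinv.mk (finPairRepW F E c N M e JV JW hcδ hδ hd hV hW hVd hWd hJV hJW hs) χ' f) =
          TwistedCoinv.mk _ χ'' f) ∧
      ∀ (k : UnitaryGroup.finAdelic F E c N JV)
        (x : TwistedCoinv.Coinv (finPairRepW F E c N M e JV JW hcδ hδ hd hV hW hVd hWd hJV hJW hs) χ'),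
        T (weilCoinv F E c N M e JV JW hcδ hδ hd hV hW hVd hWd hJV hJW χ' hs k x) =
          ((χ (k, 1) : ℂˣ) : ℂ) •
            TwistedCoinv.rep χ''
              ((finRepMp (isUnit_kronecker_map F N hVd hWd) s₀
                (harch_reference F E c N M e JV JW hcδ hδ hd hV hW hVd hWd hJV hJW s₀ hproj hs)).comp
                  (MonoidHom.inl _ _))
              (commute_comp_inl_comp_inr _) k (T x) := by
  refine ⟨Submodule.quotEquivOfEq _ _
    (ker_finPairRepW_eq_of_eq_twist F E c N M e JV JW hcδ hδ hd hV hW hVd hWd hJV hJW hproj hχ hs hχ'),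
    fun f => rfl, fun k x => ?_⟩
  obtain ⟨f, rfl⟩ := TwistedCoinv.mk_surjective _ χ' x
  have h := finPairRepV_eq_smul_of_eq_twist F E c N M e JV JW hcδ hδ hd hV hW hVd hWd hJV hJW hproj hχ hs k f
  rw [finPairRepV_apply] at h
  change TwistedCoinv.mk _ χ'' (finPairRep F E c N M e JV JW hcδ hδ hd hV hW hVd hWd hJV hJW hs (k, 1) f) =
    ((χ (k, 1) : ℂˣ) : ℂ) • TwistedCoinv.mk _ χ''
      (finRepMp (isUnit_kronecker_map F N hVd hWd) s₀
        (harch_reference F E c N M e JV JW hcδ hδ hd hV hW hVd hWd hJV hJW s₀ hproj hs) (k, 1) f)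
  rw [h, map_smul]

include hχ hχ' in
/-- **non-vanishing transfers**: `Ω(s, χ') ≠ 0 ↔ Coinv(ω_f^{s₀}|_{U(J_W)}, χ'') ≠ 0` — the non-vanishing clause of
[Liu2021, Def. 4.11 / Lemma D.1 (1)] for the abstract-`s` carrier is EQUIVALENT to the same clause for any reference
section. [cite: Liu2021, App. D §D.1 Step 3 (l. 5219); GelbartRogawski1991, §3.1 Remark p. 457 L4–13] -/
theorem nontrivial_weilCoinv_iff_reference :
    Nontrivial (TwistedCoinv.Coinv (finPairRepW F E c N M e JV JW hcδ hδ hd hV hW hVd hWd hJV hJW hs) χ') ↔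
      Nontrivial (TwistedCoinv.Coinv ((finRepMp (isUnit_kronecker_map F N hVd hWd) s₀
        (harch_reference F E c N M e JV JW hcδ hδ hd hV hW hVd hWd hJV hJW s₀ hproj hs)).comp
          (MonoidHom.inr _ _)) χ'') :=
  (Submodule.quotEquivOfEq _ _
    (ker_finPairRepW_eq_of_eq_twist F E c N M e JV JW hcδ hδ hd hV hW hVd hWd hJV hJW hproj hχ hs hχ')).toEquiv.nontrivial_congr

end Reference

end Literature.NumberTheory.GelbartRogawski1991.UnitaryDualPair.WeilCoinv

/-! ### Build-lane note (ops-buildfix G11b-3 recipe v2, LEDGER B13-1/B14-5/B14-7, 2026-08-22)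
`lean -o` (the hub build lane, never `lean`/the gate check) runs Lean 4.32's library-suggestion indexers
(`Lean.LibrarySuggestions.SymbolFrequency` / `SineQuaNon`, from their `exportEntriesFn`) over the statement of every local
theorem constant that is not a denied premise; on this family's statements (very large dependent binder telescopes) that fold
runs for many minutes (incident G11b-3, run/shared/lean/ops/buildfix/G11b-3-DOSSIER.md; this file: child `lean -o` 492 s,
in-file census 16 constants, proxy 2.6e+12). `isDeniedPremise` skips `[implicit_reducible]` constants before any fold, and the
status is inert on theorems (Meta never unfolds `thmInfo`). v2 form: ONE file-final, top-level `local` attribute — synchronous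
scoped reducibility extension, read first by `getReducibilityStatusCore`, never popped before export, not exported, no
`Elab.async false` needed; it also covers auto-realized `*.congr_simp` / structure-projection theorem constants.
No statement or proof is changed. -/
set_option allowUnsafeReducibility true in
attribute [local implicit_reducible]
  Literature.NumberTheory.GelbartRogawski1991.UnitaryDualPair.WeilCoinv.exists_weilCoinv_equiv_reference
  Literature.NumberTheory.GelbartRogawski1991.UnitaryDualPair.WeilCoinv.finPairRep_eq_smul_of_eq_twist
  Literature.NumberTheory.GelbartRogawski1991.UnitaryDualPair.WeilCoinv.ker_finPairRepW_eq_of_eq_twist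
  Literature.NumberTheory.GelbartRogawski1991.UnitaryDualPair.WeilCoinv.nontrivial_weilCoinv_iff_reference
  Literature.NumberTheory.GelbartRogawski1991.UnitaryDualPair.WeilCoinv.finPairRepW_eq_smul_of_eq_twist
  Literature.NumberTheory.GelbartRogawski1991.UnitaryDualPair.WeilCoinv.finPairRepV_eq_smul_of_eq_twist
  Literature.NumberTheory.GelbartRogawski1991.UnitaryDualPair.WeilCoinv.exists_eq_twist_finPairSection_continuous
  Literature.NumberTheory.GelbartRogawski1991.UnitaryDualPair.WeilCoinv.exists_eq_twist_finPairSection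
  Literature.NumberTheory.GelbartRogawski1991.UnitaryDualPair.WeilCoinv.proj_eq_proj_finPairSection_of_intrinsic
  Literature.NumberTheory.GelbartRogawski1991.UnitaryDualPair.WeilCoinv.harch_reference
  Literature.NumberTheory.GelbartRogawski1991.UnitaryDualPair.WeilCoinv.exists_eq_twist_of_isCompatible
  Literature.NumberTheory.GelbartRogawski1991.UnitaryDualPair.WeilCoinv.exists_reference_section
  Literature.NumberTheory.GelbartRogawski1991.UnitaryDualPair.WeilCoinv.exists_central_twist_of_isCompatible
  Literature.NumberTheory.GelbartRogawski1991.UnitaryDualPair.WeilCoinv.splittingDatum_hker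
  Literature.NumberTheory.GelbartRogawski1991.UnitaryDualPair.WeilCoinv.commute_comp_inl_comp_inr
  Literature.NumberTheory.GelbartRogawski1991.UnitaryDualPair.WeilCoinv.isUnit_adelicGram
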